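/-
Copyright (c) 2026 the pub-hodgecm-mathlib formalisation cell (harness21).  Prover seat hodgecm-mathlib-K2E3-p25 (g0), HCML Track B «K2-LIT»,
h413 = `stmt-HodgeConjecture-24833`, road (11-3-split-nsc), leaf (nsc-S-A′) `sig_K2E3GL3PrincipalBlockStandardSpan`, brick E3γ1 «ONE BRUHAT CELL CONTRIBUTES AT
MOST A LINE TO THE JACQUET MODULE» of the leaf owner's memo `K2/K2E3-p25/g0/MEMO-SA-architecture.v1.K2E3-p25-g0.md`.  2026-09-04.
-/
import Literature.NumberTheory.Automorphic.ParabolicBruhatCellSupport          -- ★ `exists_isCompact_support_of_eq_zero_on_cellLT`, cells `cellLT/cellLE`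
import Literature.NumberTheory.Automorphic.InducedWhittakerVanishing           -- ★ `vanishingOn`
import Literature.NumberTheory.Automorphic.SmoothIndOpenCellCoinvariants        -- ★ `cellFunMap`, `isSmooth_compactlySupported`
import Literature.NumberTheory.Automorphic.CompactlySupportedCoinvariants       -- ★ `compactlySupported`, `finrank_coinvariants_compactlySupported_le`
import Literature.NumberTheory.Automorphic.WhittakerTwistedJacquet             -- ★ `coinvariantsMap_injective_of_isLimitOfCompactOpen`
import Literature.NumberTheory.Automorphic.ParabolicGL                         -- ★ `restrictUnipotentGL`
import HarnessLib

/-!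
# K2_E3 road (h413), leaf (nsc-S-A′), brick E3γ1 — the Bruhat filtration of `Ind_B^{GL_n} θ′`: ONE CELL CONTRIBUTES AT MOST A LINE to the
# Borel Jacquet module (the upper-bound half of the geometric lemma, per cell, measure-free)

Cell `pub/hodgecm-mathlib` (D-0151), Track B, seat K2E3-p25 (g0) (leaf owner).  `--supports stmt-HodgeConjecture-24833 --as helper`; THEOREMS ONLY; generic `n`;
never imports `Cruxes/…/Lines`.  COUNT-NEUTRAL.

THE MATHEMATICS ([BernsteinZelevinsky1977, Thm. 5.2 (geometric lemma) for the pair `(B, B)`]; [Casselman1995, §6.3, Thm. 6.3.5]).  `F` non-archimedean local, `G = GL_n(F)`,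
`B = P_{id}` the upper Borel, `U = U_n` its radical, `σ′` a smooth character of `B` trivial on `U` (e.g. `θ ∘ proj ⊗ δ^{1∕2}`), `I = Ind_B^G σ′` (★ `smoothIndRep`).  For a
permutation `w` the cell `C_w = B P_w U` is relatively open in the closed `cellLE id w = cellLT id w ∪ C_w` (★ `ParabolicBruhatCellsTopology`), giving the `U`-stable subspaces
`X^< = vanishingOn (cellLT id w) ≥ X^≤ = vanishingOn (cellLE id w)` of `I` (★ `vanishingOn`).  A **cell datum** for `w` is a pair of subgroups `S, Γ ≤ U` with
`S = {u ∈ U : P_w u P_w⁻¹ ∈ B}` (the stabiliser) and a continuous retraction `proj : U → Γ` with `u ∈ S · proj u`, `proj (s γ) = γ` — i.e. `U = S · Γ` — so that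
`C_w = B P_w Γ`.  (For `GL₃` the six data are `(U, 1)`, `(U_{P₂₁}, U ∩ M_{P₂₁})`, `(U_{P₁₂}, U ∩ M_{P₁₂})`, `(U ∩ M_{P₁₂}, U_{P₁₂})`, `(U ∩ M_{P₂₁}, U_{P₂₁})`, `(1, U)`; brick E3β.)
RESULTS, for such a datum:
* §1 `mem_vanishingOn_cellLE_of_cellFun_eq_zero` — an `f ∈ X^<` whose CELL FUNCTION `γ ↦ f(P_w γ)` vanishes on `Γ` lies in `X^≤`;
* §2 `hasCompactSupport_cellFun_of_mem_vanishingOn_cellLT` — the cell function of `f ∈ X^<` has COMPACT SUPPORT on `Γ` (★ `exists_isCompact_support_of_eq_zero_on_cellLT` +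
  the retraction);
* §3 **`finrank_quot_le_one_of_cellDatum`** — with `J = r_U(I)` the `U`-coinvariants in the tree's `GL_n` currency (★ `restrictUnipotentGL F id`, carrier of ★ `jacquetGL` ∕
  ★ `normalizedJacquetGL`) and `F^< = [X^<]`, `F^≤ = [X^≤]` their images: `F^< ⁄ F^≤` is finite-dimensional of dimension **at most one**.  Proof: the cell-function map descends
  to an injective `Γ`-map `X^< ⁄ X^≤ ↪ C_c^∞(Γ, ℂ)` (§1, §2), so by left exactness of `Γ`-coinvariants (★ `coinvariantsMap_injective_of_isLimitOfCompactOpen`) and ★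
  `finrank_coinvariants_compactlySupported_le`, `dim (X^< ⁄ X^≤)_Γ ≤ 1`; and `F^< ⁄ F^≤` is a quotient of `(X^< ⁄ X^≤)_Γ` (`Γ ≤ U` acts trivially on `J`).
The complementary lower bound (a `U`-invariant Haar functional on `X^<` non-zero on a section at `P_w`) and the torus character are brick E3γ2; the multiplicities then follow
from ★ E3α `K2E3JacquetFiltrationMultiplicity`.

HONEST LABEL: HC_CM is proved only modulo the 7 printed citations (2 remaining named inputs: hLiu418 = stmt-HodgeConjecture-24832, h413 = stmt-HodgeConjecture-24833) until rung 0
closes; count-neutral generic helper.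

## References
* [BernsteinZelevinsky1977] I. N. Bernstein, A. V. Zelevinsky, *Induced representations of reductive p-adic groups I*, Ann. Sci. ÉNS 10 (1977), Prop. 1.9 (a), §2.12, Thm. 5.2.
* [Casselman1995] W. Casselman, *Introduction to the theory of admissible representations of p-adic reductive groups* (draft 1 May 1995), §6.3 (Thm. 6.3.5), Lemma 7.1.1.
-/

set_option autoImplicit false
set_option linter.dupNamespace false

noncomputable section

open Module Set Function Representation
open scoped MatrixGroups

namespace Summit.HodgeConjecture.HodgeConjecture.Cruxes.H413.K2E3BorelCellCoinvariantsBound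

open Literature.NumberTheory.Automorphic

variable {F : Type} [Field F] [ValuativeRel F] [TopologicalSpace F] [IsNonarchimedeanLocalField F] {n : ℕ}

/-! ## §0 Two `GL_n` lemmas: conjugates of unitriangular matrices landing in `B`; the `U`-relations of the `GL_n` Jacquet module -/

omit [ValuativeRel F] [TopologicalSpace F] [IsNonarchimedeanLocalField F] in
/-- A unitriangular matrix conjugated by a permutation matrix has unit diagonal; if the conjugate is upper triangular it is unitriangular. [folklore] -/
theorem permGL_conj_mem_upperUnitriangular (w : Equiv.Perm (Fin n)) {u : GL (Fin n) F} (hu : u ∈ upperUnitriangular (Fin n) F)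
    (hB : (permGL w : GL (Fin n) F) * u * (permGL w)⁻¹ ∈ standardParabolicGL F (id : Fin n → Fin n)) :
    (permGL w : GL (Fin n) F) * u * (permGL w)⁻¹ ∈ upperUnitriangular (Fin n) F := by
  rw [mem_upperUnitriangular_iff]
  refine ⟨hB, fun i => ?_⟩
  have hcoe := coe_permGL_mul_mul_inv (K := F) w u
  rw [hcoe]
  exact ((mem_upperUnitriangular_iff u).1 hu).2 _

omit [ValuativeRel F] [TopologicalSpace F] [IsNonarchimedeanLocalField F] in
/-- The unipotent radical `U_c` of a standard parabolic is the image of `unipotentRadicalP` (the kernel of the Levi projection): an element of `U_c` lifts to `P_c`.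
[cite: BernsteinZelevinsky1977, §2.1] -/
theorem exists_unipotentRadicalP_coe_eq {α : Type*} [LinearOrder α] (c : Fin n → α) {u : GL (Fin n) F} (hu : u ∈ unipotentRadicalGL F c) :
    ∃ p : ↥(unipotentRadicalP F c), ((p : ↥(standardParabolicGL F c)) : GL (Fin n) F) = u := by
  obtain ⟨p, hp, rfl⟩ := hu
  exact ⟨⟨p, hp⟩, rfl⟩

omit [ValuativeRel F] [TopologicalSpace F] [IsNonarchimedeanLocalField F] in
/-- **The class of `u · v − v` vanishes in the `GL_n` Jacquet module** `r_c(V) = V ⁄ ⟨π(u)v − v : u ∈ U_c⟩` (★ `restrictUnipotentGL`), for `u ∈ U_c ≤ GL_n`.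
[cite: BernsteinZelevinsky1977, §1.8, §2.3] -/
theorem mk_restrictUnipotentGL_apply_sub_self {α : Type*} [LinearOrder α] (c : Fin n → α) {V : Type*} [AddCommGroup V] [Module ℂ V]
    (π : Representation ℂ (GL (Fin n) F) V) {u : GL (Fin n) F} (hu : u ∈ unipotentRadicalGL F c) (v : V) :
    Coinvariants.mk (restrictUnipotentGL F c π) (π u v - v) = 0 := by
  obtain ⟨p, hp⟩ := exists_unipotentRadicalP_coe_eq c hu
  rw [Coinvariants.mk_eq_zero]
  have := Coinvariants.sub_mem_ker (ρ := restrictUnipotentGL F c π) p v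
  rwa [show restrictUnipotentGL F c π p v = π u v from by rw [← hp]; rfl] at this

omit [ValuativeRel F] [TopologicalSpace F] [IsNonarchimedeanLocalField F] in
/-- Right translation by `u ∈ U_c` does not change the class in the `GL_n` Jacquet module. [cite: BernsteinZelevinsky1977, §1.8, §2.3] -/
theorem mk_restrictUnipotentGL_apply_eq {α : Type*} [LinearOrder α] (c : Fin n → α) {V : Type*} [AddCommGroup V] [Module ℂ V]
    (π : Representation ℂ (GL (Fin n) F) V) {u : GL (Fin n) F} (hu : u ∈ unipotentRadicalGL F c) (v : V) :
    Coinvariants.mk (restrictUnipotentGL F c π) (π u v) = Coinvariants.mk (restrictUnipotentGL F c π) v := by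
  rw [← sub_eq_zero, ← map_sub, mk_restrictUnipotentGL_apply_sub_self c π hu v]

/-! ## §1 The cell `B P_w U = B P_w Γ` and the cell function on `Γ` -/

section Cell

variable (σ' : Representation ℂ ↥(standardParabolicGL F (id : Fin n → Fin n)) ℂ)
  (w : Equiv.Perm (Fin n)) (Γ S : Subgroup (GL (Fin n) F))

/-- **The vanishing locus on the cell**: with a cell datum `U = S · Γ` (`P_w S P_w⁻¹ ⊆ B`), an `f ∈ Ind_B^G σ′` vanishing on the smaller cells `cellLT id w` and whose cell
function `γ ↦ f(P_w γ)` vanishes on `Γ` vanishes on `cellLE id w` (every point of the cell is `b P_w s γ = (b P_w s P_w⁻¹) P_w γ`).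
[cite: BernsteinZelevinsky1977, Thm. 5.2] [cite: Casselman1995, §6.3] -/
theorem mem_vanishingOn_cellLE_of_cellFun_eq_zero
    (hSB : ∀ s ∈ S, (permGL w : GL (Fin n) F) * s * (permGL w)⁻¹ ∈ standardParabolicGL F (id : Fin n → Fin n))
    (hdec : ∀ u ∈ upperUnitriangular (Fin n) F, ∃ s ∈ S, ∃ γ ∈ Γ, u = s * γ)
    (f : SmoothInd (standardParabolicGL F (id : Fin n → Fin n)) σ')
    (hf : f ∈ vanishingOn (standardParabolicGL F (id : Fin n → Fin n)) σ' (cellLT (K := F) (id : Fin n → Fin n) w))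
    (hzero : ∀ γ ∈ Γ, f.toFun ((permGL w : GL (Fin n) F) * γ) = 0) :
    f ∈ vanishingOn (standardParabolicGL F (id : Fin n → Fin n)) σ' (cellLE (K := F) (id : Fin n → Fin n) w) := by
  intro g hg
  rw [cellLE_eq_cellLT_union] at hg
  rcases hg with hg | hg
  · exact hf g hg
  · obtain ⟨p, hp, u, hu, rfl⟩ := hg
    obtain ⟨s, hs, γ, hγ, rfl⟩ := hdec u hu
    have hb : p * ((permGL w : GL (Fin n) F) * s * (permGL w)⁻¹) ∈ standardParabolicGL F (id : Fin n → Fin n) :=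
      Subgroup.mul_mem _ hp (hSB s hs)
    have heq : p * (permGL w : GL (Fin n) F) * (s * γ) =
        ((⟨_, hb⟩ : ↥(standardParabolicGL F (id : Fin n → Fin n))) : GL (Fin n) F) * ((permGL w : GL (Fin n) F) * γ) := by
      simp only [mul_assoc, inv_mul_cancel_left]
    rw [heq, SmoothInd.toFun_subgroup_mul, hzero γ hγ, map_zero]

/-- **Compact support of the cell function.**  For `f ∈ Ind_B^G σ′` vanishing on `cellLT id w`, the cell function `γ ↦ f(P_w γ)` on `Γ` is supported in `proj(C)` for the compact
`C ⊆ U` of ★ `exists_isCompact_support_of_eq_zero_on_cellLT` (`f(P_w u) ≠ 0 ⇒ u ∈ S·C`, and the `Γ`-component of `s c` is that of `c`).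
[cite: BernsteinZelevinsky1977, §5.14, Thm. 5.2] [cite: Casselman1995, §6.3 (proof of Prop. 6.3.1)] -/
theorem hasCompactSupport_cellFun_of_mem_vanishingOn_cellLT (hΓU : Γ ≤ upperUnitriangular (Fin n) F)
    (hS : ∀ u ∈ upperUnitriangular (Fin n) F,
      (permGL w : GL (Fin n) F) * u * (permGL w)⁻¹ ∈ standardParabolicGL F (id : Fin n → Fin n) → u ∈ S)
    (proj : ↥(upperUnitriangular (Fin n) F) → ↥Γ) (hproj : Continuous proj)
    (hprojS : ∀ (s : GL (Fin n) F) (hs : s ∈ upperUnitriangular (Fin n) F) (_ : s ∈ S) (γ : ↥Γ),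
      proj ⟨s * γ, Subgroup.mul_mem _ hs (hΓU γ.2)⟩ = γ)
    (f : SmoothInd (standardParabolicGL F (id : Fin n → Fin n)) σ')
    (hf : f ∈ vanishingOn (standardParabolicGL F (id : Fin n → Fin n)) σ' (cellLT (K := F) (id : Fin n → Fin n) w)) :
    HasCompactSupport fun γ : ↥Γ => f.toFun ((permGL w : GL (Fin n) F) * (γ : GL (Fin n) F)) := by
  haveI : IsTopologicalRing F := inferInstance
  -- `B`-invariance of the support and the support lemma
  have hPinv : ∀ p ∈ standardParabolicGL F (id : Fin n → Fin n), ∀ g, f.toFun (p * g) ≠ 0 ↔ f.toFun g ≠ 0 := by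
    intro p hp g
    rw [show p * g = ((⟨p, hp⟩ : ↥(standardParabolicGL F (id : Fin n → Fin n))) : GL (Fin n) F) * g from rfl, SmoothInd.toFun_subgroup_mul,
      not_iff_not]
    constructor
    · intro h
      have := congrArg (σ' (⟨p, hp⟩ : ↥(standardParabolicGL F (id : Fin n → Fin n)))⁻¹) h
      rwa [map_zero, ← Module.End.mul_apply, ← map_mul, inv_mul_cancel, map_one, Module.End.one_apply] at this
    · intro h
      rw [h, map_zero]
  obtain ⟨C, hC, hCsupp⟩ := exists_isCompact_support_of_eq_zero_on_cellLT (F := F) (id : Fin n → Fin n) monotone_id w f.toFun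
    (Literature.NumberTheory.Automorphic.Representation.SmoothInd.isClosed_setOf_toFun_ne_zero f) hPinv hf
  -- the support of the cell function lies in `proj '' C`
  refine HasCompactSupport.of_support_subset_isCompact (hC.image hproj) fun γ hγ => ?_
  rw [Function.mem_support] at hγ
  obtain ⟨v, hvC, hv⟩ := hCsupp ⟨γ, hΓU γ.2⟩ hγ
  -- `γ v⁻¹ ∈ S`, so `γ = s v` and `proj v = γ`
  set s : GL (Fin n) F := ((⟨(γ : GL (Fin n) F), hΓU γ.2⟩ * v⁻¹ : ↥(upperUnitriangular (Fin n) F)) : GL (Fin n) F) with hs_def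
  have hsU : s ∈ upperUnitriangular (Fin n) F := SetLike.coe_mem _
  have hsS : s ∈ S := hS s hsU hv
  refine ⟨v, hvC, ?_⟩
  have hγeq : (γ : GL (Fin n) F) = s * (v : GL (Fin n) F) := by
    rw [hs_def, Subgroup.coe_mul, Subgroup.coe_inv, inv_mul_cancel_right]
  have hs'S : s⁻¹ ∈ S := S.inv_mem hsS
  have hs'U : s⁻¹ ∈ upperUnitriangular (Fin n) F := Subgroup.inv_mem _ hsU
  have hv' : v = ⟨s⁻¹ * γ, Subgroup.mul_mem _ hs'U (hΓU γ.2)⟩ := by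
    apply Subtype.ext
    change (v : GL (Fin n) F) = s⁻¹ * γ
    rw [hγeq, inv_mul_cancel_left]
  rw [hv']
  exact hprojS s⁻¹ hs'U hs'S γ

end Cell

/-! ## §2b Stability of `vanishingOn (cellLT ∕ cellLE)` under right translation by `U` -/

/-- Right translation by `u ∈ U` preserves `cellsBelow id D` (the cells are right-`U`-stable), hence `vanishingOn` of it. [cite: BernsteinZelevinsky1977, Thm. 5.2] -/
theorem smoothIndRep_mem_vanishingOn_cellsBelow (σ' : Representation ℂ ↥(standardParabolicGL F (id : Fin n → Fin n)) ℂ)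
    (D : Set (ℕ ×ₗ Lex (Fin n → Fin n))) {u : GL (Fin n) F} (hu : u ∈ upperUnitriangular (Fin n) F)
    {f : SmoothInd (standardParabolicGL F (id : Fin n → Fin n)) σ'}
    (hf : f ∈ vanishingOn (standardParabolicGL F (id : Fin n → Fin n)) σ' (cellsBelow (K := F) (id : Fin n → Fin n) D)) :
    smoothIndRep (standardParabolicGL F (id : Fin n → Fin n)) σ' u f ∈
      vanishingOn (standardParabolicGL F (id : Fin n → Fin n)) σ' (cellsBelow (K := F) (id : Fin n → Fin n) D) :=
  smoothIndRep_apply_mem_vanishingOn (fun g hg => by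
    simpa only [one_mul] using mul_mul_mem_cellsBelow (K := F) (id : Fin n → Fin n) hg (Subgroup.one_mem _) hu) hf

/-! ## §3 The quotient `X^< ⁄ X^≤` injects `Γ`-equivariantly into `C_c^∞(Γ)`; the image of the cell in `r_U(I)` is at most a line -/

section Bound

variable (σ' : Representation ℂ ↥(standardParabolicGL F (id : Fin n → Fin n)) ℂ)
  (w : Equiv.Perm (Fin n)) (Γ S : Subgroup (GL (Fin n) F))

set_option maxHeartbeats 800000 in
/-- **ONE CELL CONTRIBUTES AT MOST A LINE.**  For a cell datum `(S, Γ, proj)` of `w` (`U = S·Γ`, `S` the stabiliser `{u ∈ U : P_w u P_w⁻¹ ∈ B}`, `proj` a continuous retraction,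
`Γ` a union of compact open subgroups) and any representation `σ′` of `B` on `ℂ`: with `J = r_U(Ind_B^G σ′)` in the tree's `GL_n` currency (★ `restrictUnipotentGL F id`),
`F^< = [vanishingOn (cellLT id w)]`, `F^≤ = [vanishingOn (cellLE id w)]`, the quotient `F^< ⁄ F^≤` is finite-dimensional of dimension `≤ 1`.
[cite: BernsteinZelevinsky1977, Prop. 1.9 (a), Thm. 5.2] [cite: Casselman1995, §6.3 Thm. 6.3.5, Lemma 7.1.1 (a)] -/
theorem finrank_quot_le_one_of_cellDatum (hΓU : Γ ≤ upperUnitriangular (Fin n) F) (hΓlim : IsLimitOfCompactOpen ↥Γ)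
    (hS : ∀ u ∈ upperUnitriangular (Fin n) F,
      (permGL w : GL (Fin n) F) * u * (permGL w)⁻¹ ∈ standardParabolicGL F (id : Fin n → Fin n) → u ∈ S)
    (hSB : ∀ s ∈ S, (permGL w : GL (Fin n) F) * s * (permGL w)⁻¹ ∈ standardParabolicGL F (id : Fin n → Fin n))
    (hdec : ∀ u ∈ upperUnitriangular (Fin n) F, ∃ s ∈ S, ∃ γ ∈ Γ, u = s * γ)
    (proj : ↥(upperUnitriangular (Fin n) F) → ↥Γ) (hproj : Continuous proj)
    (hprojS : ∀ (s : GL (Fin n) F) (hs : s ∈ upperUnitriangular (Fin n) F) (_ : s ∈ S) (γ : ↥Γ),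
      proj ⟨s * γ, Subgroup.mul_mem _ hs (hΓU γ.2)⟩ = γ) :
    let mk := Coinvariants.mk (restrictUnipotentGL F (id : Fin n → Fin n) (smoothIndRep (standardParabolicGL F (id : Fin n → Fin n)) σ'))
    let Flt := (vanishingOn (standardParabolicGL F (id : Fin n → Fin n)) σ' (cellLT (K := F) (id : Fin n → Fin n) w)).map mk
    let Fle := (vanishingOn (standardParabolicGL F (id : Fin n → Fin n)) σ' (cellLE (K := F) (id : Fin n → Fin n) w)).map mk
    FiniteDimensional ℂ (↥Flt ⧸ Fle.comap Flt.subtype) ∧ finrank ℂ (↥Flt ⧸ Fle.comap Flt.subtype) ≤ 1 := by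
  intro mk Flt Fle
  haveI : IsTopologicalRing F := inferInstance
  let B := standardParabolicGL F (id : Fin n → Fin n)
  let I := smoothIndRep B σ'
  let Xlt := vanishingOn B σ' (cellLT (K := F) (id : Fin n → Fin n) w)
  let Xle := vanishingOn B σ' (cellLE (K := F) (id : Fin n → Fin n) w)
  have hle : Xle ≤ Xlt := vanishingOn_mono (cellLT_subset_cellLE (K := F) (id : Fin n → Fin n) w)
  -- `Γ`-stability of `X^<`, `X^≤`
  have hstab_lt : ∀ γ : ↥Γ, ∀ f ∈ Xlt, I (γ : GL (Fin n) F) f ∈ Xlt := fun γ f hf =>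
    smoothIndRep_mem_vanishingOn_cellsBelow σ' _ (hΓU γ.2) hf
  have hstab_le : ∀ γ : ↥Γ, ∀ f ∈ Xle, I (γ : GL (Fin n) F) f ∈ Xle := fun γ f hf =>
    smoothIndRep_mem_vanishingOn_cellsBelow σ' _ (hΓU γ.2) hf
  -- the `Γ`-representation on `X^<` and its quotient by `X^≤`
  let ρ₁ : Representation ℂ ↥Γ ↥Xlt :=
    { toFun := fun γ => (I (γ : GL (Fin n) F)).restrict (fun f hf => hstab_lt γ f hf)
      map_one' := by ext f; simp
      map_mul' := fun γ γ' => by ext f; simp [Module.End.mul_apply] }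
  let Xle' : Submodule ℂ ↥Xlt := Xle.comap Xlt.subtype
  have hXle'st : ∀ γ : ↥Γ, Xle' ≤ Xle'.comap (ρ₁ γ) := fun γ f hf => hstab_le γ f hf
  let ρ₂ : Representation ℂ ↥Γ (↥Xlt ⧸ Xle') := ρ₁.quotient Xle' hXle'st
  have hρ₂_mk : ∀ (γ : ↥Γ) (f : ↥Xlt), ρ₂ γ (Submodule.Quotient.mk f) = Submodule.Quotient.mk (ρ₁ γ f) := fun _ _ => rfl
  -- the cell-function map into `C_c^∞(Γ, ℂ)`
  let c₀ : ↥Xlt →ₗ[ℂ] SmoothInd (⊥ : Subgroup ↥Γ) (Representation.trivial ℂ (⊥ : Subgroup ↥Γ) ℂ) :=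
    (cellFunMap (k := ℂ) B σ' Γ (permGL w : GL (Fin n) F)).comp Xlt.subtype
  have hc₀supp : ∀ f : ↥Xlt, c₀ f ∈ compactlySupported ℂ ↥Γ ℂ := by
    intro f
    have hcs := hasCompactSupport_cellFun_of_mem_vanishingOn_cellLT σ' w Γ S hΓU hS proj hproj hprojS f.1 f.2
    rw [mem_compactlySupported_iff]
    refine ⟨tsupport fun γ : ↥Γ => (f.1).toFun ((permGL w : GL (Fin n) F) * (γ : GL (Fin n) F)), hcs, fun γ hγ => ?_⟩
    rw [show (c₀ f).toFun γ = (f.1).toFun ((permGL w : GL (Fin n) F) * (γ : GL (Fin n) F)) from rfl]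
    exact image_eq_zero_of_notMem_tsupport (f := fun γ : ↥Γ => (f.1).toFun ((permGL w : GL (Fin n) F) * (γ : GL (Fin n) F))) hγ
  let c₁ : ↥Xlt →ₗ[ℂ] ↥(compactlySupported ℂ ↥Γ ℂ).toSubmodule := LinearMap.codRestrict _ c₀ hc₀supp
  have hc₁_le : Xle' ≤ LinearMap.ker c₁ := by
    intro f hf
    rw [LinearMap.mem_ker]
    apply Subtype.ext
    apply SmoothInd.ext
    funext γ
    change (f.1).toFun ((permGL w : GL (Fin n) F) * (γ : GL (Fin n) F)) = (0 : SmoothInd (⊥ : Subgroup ↥Γ) _).toFun γ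
    rw [show (0 : SmoothInd (⊥ : Subgroup ↥Γ) (Representation.trivial ℂ (⊥ : Subgroup ↥Γ) ℂ)).toFun γ = 0 from rfl]
    exact hf _ ⟨w, Set.mem_Iic.2 le_rfl, 1, Subgroup.one_mem _, γ, hΓU γ.2, by rw [one_mul]⟩
  let c₂ : (↥Xlt ⧸ Xle') →ₗ[ℂ] ↥(compactlySupported ℂ ↥Γ ℂ).toSubmodule := Xle'.liftQ c₁ hc₁_le
  have hc₂_mk : ∀ f : ↥Xlt, c₂ (Submodule.Quotient.mk f) = c₁ f := fun _ => rfl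
  -- injectivity (§1)
  have hc₂inj : Function.Injective c₂ := by
    rw [injective_iff_map_eq_zero]
    intro x hx
    obtain ⟨f, rfl⟩ := Submodule.Quotient.mk_surjective Xle' x
    rw [hc₂_mk] at hx
    have hzero : ∀ γ ∈ Γ, (f.1).toFun ((permGL w : GL (Fin n) F) * γ) = 0 := by
      intro γ hγ
      have := congrArg (fun y : ↥(compactlySupported ℂ ↥Γ ℂ).toSubmodule =>
        (y : SmoothInd (⊥ : Subgroup ↥Γ) (Representation.trivial ℂ (⊥ : Subgroup ↥Γ) ℂ)).toFun ⟨γ, hγ⟩) hx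
      exact this
    exact (Submodule.Quotient.mk_eq_zero Xle').2 (mem_vanishingOn_cellLE_of_cellFun_eq_zero σ' w Γ S hSB hdec f.1 f.2 hzero)
  -- `Γ`-equivariance
  let cI : ρ₂.IntertwiningMap (compactlySupported ℂ ↥Γ ℂ).toRepresentation :=
    { toLinearMap := c₂
      isIntertwining' := fun γ => by
        refine LinearMap.ext fun x => ?_
        obtain ⟨f, rfl⟩ := Submodule.Quotient.mk_surjective Xle' x
        simp only [LinearMap.coe_comp, Function.comp_apply]
        rw [hρ₂_mk, hc₂_mk, hc₂_mk]
        apply Subtype.ext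
        exact cellFunMap_apply_smoothIndRep (k := ℂ) B σ' Γ (permGL w : GL (Fin n) F) f.1 γ }
  have hcIinj : Function.Injective cI := hc₂inj
  have hmapinj := coinvariantsMap_injective_of_isLimitOfCompactOpen hΓlim (isSmooth_compactlySupported (k := ℂ) (W := ℂ) ↥Γ) cI hcIinj
  obtain ⟨hfdC, hleC⟩ := finrank_coinvariants_compactlySupported_le (k := ℂ) (N := ↥Γ) (W := ℂ) hΓlim
  haveI := hfdC
  haveI hfd₂ : FiniteDimensional ℂ ρ₂.Coinvariants := Module.Finite.of_injective _ hmapinj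
  have hdim₂ : finrank ℂ ρ₂.Coinvariants ≤ 1 :=
    (LinearMap.finrank_le_finrank_of_injective hmapinj).trans (hleC.trans (Module.finrank_self ℂ).le)
  -- the surjection `(X^< ⁄ X^≤)_Γ ↠ F^< ⁄ F^≤`
  let g₀ : ↥Xlt →ₗ[ℂ] ↥Flt := LinearMap.codRestrict Flt (mk ∘ₗ Xlt.subtype) (fun f => ⟨f.1, f.2, rfl⟩)
  let g₁ : ↥Xlt →ₗ[ℂ] (↥Flt ⧸ Fle.comap Flt.subtype) := (Fle.comap Flt.subtype).mkQ ∘ₗ g₀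
  have hg₁_le : Xle' ≤ LinearMap.ker g₁ := by
    intro f hf
    rw [LinearMap.mem_ker]
    change Submodule.Quotient.mk (g₀ f) = 0
    rw [Submodule.Quotient.mk_eq_zero, Submodule.mem_comap]
    exact ⟨f.1, hf, rfl⟩
  let g₂ : (↥Xlt ⧸ Xle') →ₗ[ℂ] (↥Flt ⧸ Fle.comap Flt.subtype) := Xle'.liftQ g₁ hg₁_le
  have hg₂_mk : ∀ f : ↥Xlt, g₂ (Submodule.Quotient.mk f) = g₁ f := fun _ => rfl
  have hg₂inv : ∀ γ : ↥Γ, g₂ ∘ₗ ρ₂ γ = g₂ := by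
    intro γ
    refine LinearMap.ext fun x => ?_
    obtain ⟨f, rfl⟩ := Submodule.Quotient.mk_surjective Xle' x
    rw [LinearMap.comp_apply, hρ₂_mk, hg₂_mk, hg₂_mk]
    change Submodule.Quotient.mk (g₀ (ρ₁ γ f)) = Submodule.Quotient.mk (g₀ f)
    congr 1
    apply Subtype.ext
    change mk (I (γ : GL (Fin n) F) f.1) = mk f.1
    exact mk_restrictUnipotentGL_apply_eq (id : Fin n → Fin n) I (hΓU γ.2) f.1
  let g₃ : ρ₂.Coinvariants →ₗ[ℂ] (↥Flt ⧸ Fle.comap Flt.subtype) := Coinvariants.lift ρ₂ g₂ hg₂inv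
  have hg₃surj : Function.Surjective g₃ := by
    intro y
    obtain ⟨x, rfl⟩ := Submodule.Quotient.mk_surjective _ y
    obtain ⟨f, hf, hfx⟩ : ∃ f ∈ Xlt, mk f = (x : _) := x.2
    refine ⟨Coinvariants.mk ρ₂ (Submodule.Quotient.mk ⟨f, hf⟩), ?_⟩
    rw [Coinvariants.lift_mk, hg₂_mk]
    change Submodule.Quotient.mk (g₀ ⟨f, hf⟩) = Submodule.Quotient.mk x
    congr 1
    exact Subtype.ext hfx
  haveI : FiniteDimensional ℂ (↥Flt ⧸ Fle.comap Flt.subtype) := Module.Finite.of_surjective g₃ hg₃surj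
  exact ⟨inferInstance, (LinearMap.finrank_le_finrank_of_surjective (f := g₃) hg₃surj |> fun h => h.trans hdim₂)⟩

end Bound



end Summit.HodgeConjecture.HodgeConjecture.Cruxes.H413.K2E3BorelCellCoinvariantsBound
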